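import Literature.Geometry.Lorentzian.NearKerrLeaf
import Literature.Geometry.Lorentzian.LeafAdaptedModelChartsMinkowski
import Literature.Geometry.Lorentzian.CauchyProblemProofs
import Literature.Geometry.Lorentzian.ExtensionProofs
import HarnessLib

/-!
# Near-Kerr leaves of Minkowski space: the time-stretched hyperboloid is an `(ε, k)`-leaf for
# every `ε > 0`, and it is not achronal

Sanity/junk record for the route-posited predicate `CauchyDevelopment.IsNearKerrLeaf`
(`NearKerrLeaf.lean`; inlined verbatim in the items `QuietLeaves`/`Capture`/`GenericLegs` of
route `FinalStateConjecture/QuietWindowCapture` and `BondiBartnikRigidity`/`GapExhaustion` of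
route `FinalStateConjecture/BartnikGapSettling`). Two facts about the Minkowski development
`Minkowski.vacuumCauchyDevelopment` of the trivial data (`MinkowskiCauchyDevelopment.lean`):

* `Minkowski.isNearKerrLeaf_stretchLeaf` — for every `k` and every real `s > 0`, the image
  `stretchLeaf a = {y | y⁰ = a √(1 + |y̲|²)}`, `a = √(1 + s)`, of the unit hyperboloid under the
  TIME-STRETCH `A_a = diag(a, 1, 1, 1)` is an `(ENNReal.ofReal s, k)`-near-Kerr leaf with `0`
  holes: the flat chart is `Ψ₀ = A_a ∘ Subtype.val` on `U₀ = ⊤`, whose metric deviation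
  `Ψ₀^* η − η = −s · dx⁰ ⊗ dx⁰` is a CONSTANT bilinear map of operator norm `≤ s` with vanishing
  derivatives (`deviationCk_stretchChart_le`); the upper layer consists of vertical time
  translates (`W ⊆ I⁺(S)`); and the barrier clause holds because `J⁻(stretchLeaf a)` is ALL of
  `E4` for `a > 1` (`mem_causalPast_stretchLeaf`). Hence the predicate is inhabited
  (`exists_isNearKerrLeaf`, the first inhabitant in the tree), for every tolerance `ε > 0`.
* `Minkowski.exists_mem_chronologicalFuture_stretchLeaf` — that leaf contains two
  chronologically related points: over the spatial points `ρ e₁` and `(ρ + 1) e₁`,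
  `ρ = 2/(a − 1)`, the time gained `a (√(1+(ρ+1)²) − √(1+ρ²))` exceeds the distance `1`. So an
  `(ε, k)`-near-Kerr leaf NEED NOT BE ACHRONAL, let alone a spacelike hyperboloidal slice: the
  stretched leaf is timelike outside the ball of radius `s^{-1/2}` and asymptotic to the
  timelike cone `|y̲| = y⁰ / a`, ending at future timelike infinity.

Why: the flat-chart clause measures `Ψ₀^* g − η` in the unweighted Cartesian `Cᵏ` sup norm
(`supCkENorm`, `KerrConvergence.lean`), while on the unit hyperboloid the coordinate normal
degenerates (`|dt₀|²_η = −1/(1 + r²)`); a perturbation of size `ε` of the COMPONENTS therefore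
flips the causal character of the fixed coordinate slab at `r ~ ε^{-1/2}`. Recorded for the
planners of the two routes (crux dossier
`Summits/FinalStateConjecture/FinalStateConjecture/Cruxes/BondiBartnikRigidity/ADDENDUM-a1.md`,
§D); nothing here is asserted about any item.

## References

* B. O'Neill, *Semi-Riemannian Geometry*, Academic Press 1983, Ch. 14, p. 402 (`I⁺`, `J⁺` of
  Minkowski space). [ONeillSemiRiemannian1983]
* M. Dafermos, G. Holzegel, I. Rodnianski, M. Taylor, arXiv:2104.08222, §1 (closeness to a
  reference metric in a chart, consequence form — the vocabulary of `IsNearKerrLeaf`).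
  [DafermosHolzegelRodnianskiTaylor2021]
-/

noncomputable section

open Set TopologicalSpace Filter Function
open scoped Manifold ContDiff Topology ENNReal

namespace Literature.Geometry.Lorentzian

namespace Minkowski

/-! ### The time stretch `A_a = diag(a, 1, 1, 1)` -/

/-- The **time stretch** `A_a v = v + (a − 1) v⁰ ∂₀ = (a v⁰, v¹, v², v³)` as a continuous linear
map of `E4`. O'Neill 1983, Ch. 14, p. 402 (coordinates of `ℝ⁴₁`). [cite: ONeillSemiRiemannian1983, Ch. 14, p. 402] -/
def timeStretch (a : ℝ) : E4 →L[ℝ] E4 :=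
  ContinuousLinearMap.id ℝ E4 + (a - 1) • (E4.dx 0).smulRight (E4.basisVector 0)

/-- `A_a v = v + ((a − 1) v⁰) ∂₀`. [folklore] -/
theorem timeStretch_apply (a : ℝ) (v : E4) :
    timeStretch a v = v + ((a - 1) * v 0) • E4.basisVector 0 := by
  simp [timeStretch, mul_smul]

/-- The time component of `A_a v` is `a v⁰`. [folklore] -/
@[simp]
theorem timeStretch_apply_zero (a : ℝ) (v : E4) : timeStretch a v 0 = a * v 0 := by
  rw [timeStretch_apply]
  simp
  ring

/-- The spatial components of `A_a v` are those of `v`. [folklore] -/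
@[simp]
theorem timeStretch_apply_succ (a : ℝ) (v : E4) (i : Fin 3) :
    timeStretch a v i.succ = v i.succ := by
  rw [timeStretch_apply]
  simp [Fin.succ_ne_zero]

/-- The spatial part of `A_a v` is that of `v`. [folklore] -/
@[simp]
theorem spatial_timeStretch (a : ℝ) (v : E4) : E4.spatial (timeStretch a v) = E4.spatial v := by
  ext i
  simp

/-- `A_a (t, y) = (a t, y)`. [folklore] -/
theorem timeStretch_ofTimeSpace (a t : ℝ) (y : E3) :
    timeStretch a (E4.ofTimeSpace t y) = E4.ofTimeSpace (a * t) y := by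
  ext μ
  refine Fin.cases ?_ (fun i => ?_) μ
  · simp
  · simp

/-- Time stretches compose multiplicatively: `A_b (A_a v) = A_{ab} v`. [folklore] -/
theorem timeStretch_timeStretch (a b : ℝ) (v : E4) :
    timeStretch b (timeStretch a v) = timeStretch (b * a) v := by
  ext μ
  refine Fin.cases ?_ (fun i => ?_) μ
  · simp [mul_assoc]
  · simp

/-- `A_1 = id`. [folklore] -/
theorem timeStretch_one (v : E4) : timeStretch 1 v = v := by
  rw [timeStretch_apply]
  simp

/-- For `a ≠ 0` the time stretch is a continuous linear automorphism with inverse `A_{a⁻¹}`.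
[folklore] -/
def timeStretchEquiv (a : ℝ) (ha : a ≠ 0) : E4 ≃L[ℝ] E4 :=
  ContinuousLinearEquiv.equivOfInverse (timeStretch a) (timeStretch a⁻¹)
    (fun v => by rw [timeStretch_timeStretch, inv_mul_cancel₀ ha, timeStretch_one])
    (fun v => by rw [timeStretch_timeStretch, mul_inv_cancel₀ ha, timeStretch_one])

/-- The underlying map of `timeStretchEquiv` is `timeStretch`. [folklore] -/
@[simp]
theorem coe_timeStretchEquiv (a : ℝ) (ha : a ≠ 0) :
    (timeStretchEquiv a ha : E4 → E4) = timeStretch a := rfl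

/-- `η(A_a v, A_a w) − η(v, w) = −(a² − 1) v⁰ w⁰`: the time stretch changes the Minkowski form by
a constant multiple of `dx⁰ ⊗ dx⁰` (O'Neill 1983, Ch. 3, p. 55, `η = −dt² + Σ dxᵢ²`).
[cite: ONeillSemiRiemannian1983, Ch. 14, p. 402] -/
theorem bilin_timeStretch_sub (a : ℝ) (v w : E4) :
    bilin (timeStretch a v) (timeStretch a w) - bilin v w = -((a ^ 2 - 1) * (v 0 * w 0)) := by
  simp only [bilin_apply, timeStretch_apply_zero, timeStretch_apply_succ]
  ring

/-- The **stretch defect** `−(a² − 1) dx⁰ ⊗ dx⁰` as a continuous bilinear map. [folklore] -/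
def stretchDefect (a : ℝ) : E4 →L[ℝ] E4 →L[ℝ] ℝ :=
  (-(a ^ 2 - 1)) • E4.tmul (E4.dx 0) (E4.dx 0)

/-- `stretchDefect a v w = −(a² − 1) v⁰ w⁰`. [folklore] -/
@[simp]
theorem stretchDefect_apply (a : ℝ) (v w : E4) :
    stretchDefect a v w = -((a ^ 2 - 1) * (v 0 * w 0)) := by
  simp [stretchDefect]
  ring

/-- Operator-norm bound `‖−(a² − 1) dx⁰ ⊗ dx⁰‖ ≤ |a² − 1|` (since `|v⁰| ≤ ‖v‖` on `E4`).
[folklore] -/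
theorem norm_stretchDefect_le (a : ℝ) : ‖stretchDefect a‖ ≤ |a ^ 2 - 1| := by
  refine ContinuousLinearMap.opNorm_le_bound _ (abs_nonneg _) fun v => ?_
  refine ContinuousLinearMap.opNorm_le_bound _ (by positivity) fun w => ?_
  rw [stretchDefect_apply, Real.norm_eq_abs, abs_neg, abs_mul, abs_mul]
  have hv : |v 0| ≤ ‖v‖ := by simpa using PiLp.norm_apply_le v 0
  have hw : |w 0| ≤ ‖w‖ := by simpa using PiLp.norm_apply_le w 0
  have h1 : |v 0| * |w 0| ≤ ‖v‖ * ‖w‖ :=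
    mul_le_mul hv hw (abs_nonneg _) (norm_nonneg _)
  calc |a ^ 2 - 1| * (|v 0| * |w 0|) ≤ |a ^ 2 - 1| * (‖v‖ * ‖w‖) :=
        mul_le_mul_of_nonneg_left h1 (abs_nonneg _)
    _ = |a ^ 2 - 1| * ‖v‖ * ‖w‖ := by ring

/-! ### `Cᵏ` sup norms of constant functions -/

/-- The `Cᵏ` sup norm of a constant function is at most the norm of the constant (its
derivatives of positive order vanish). Bartnik 1986, (1.3) (the norm); folklore. [folklore] -/
theorem supCkENorm_const_le {F G : Type*} [NormedAddCommGroup F] [NormedSpace ℝ F]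
    [NormedAddCommGroup G] [NormedSpace ℝ G] (S : Set F) (k : ℕ) (c : G) :
    supCkENorm S k (fun _ : F => c) ≤ ‖c‖ₑ := by
  refine iSup₂_le fun m _ => iSup₂_le fun x _ => ?_
  rw [← ofReal_norm, ← ofReal_norm]
  refine ENNReal.ofReal_le_ofReal ?_
  rcases Nat.eq_zero_or_pos m with rfl | hm
  · rw [norm_iteratedFDeriv_zero]
  · rw [iteratedFDeriv_const_of_ne hm.ne', Pi.zero_apply, norm_zero]
    exact norm_nonneg _

/-! ### The stretched flat chart and its deviation -/

/-- The **time-stretched flat chart** `Ψ₀ = A_a ∘ ι : ⊤ → E4` of the Minkowski development on the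
hyperboloidal background `hypBackground ⊤` (DHRT arXiv:2104.08222, §1: a chart in which closeness
to `η` is measured). [cite: DafermosHolzegelRodnianskiTaylor2021, §1] -/
def stretchChart (a : ℝ) : (hypBackground ⊤).domain → E4 := fun x => timeStretch a x.1

/-- Unfolding: `stretchChart a x = A_a x`. [folklore] -/
@[simp]
theorem stretchChart_apply (a : ℝ) (x : (hypBackground ⊤).domain) :
    stretchChart a x = timeStretch a x.1 := rfl

/-- The stretched chart is `C^∞` (a continuous linear map after the inclusion of an open
subset). [folklore] -/
theorem contMDiff_stretchChart (a : ℝ) :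
    ContMDiff 𝓘(ℝ, E4) (𝓡 4) ∞ (stretchChart a) :=
  (timeStretch a).contMDiff.comp contMDiff_subtype_val

/-- The manifold derivative of the stretched chart is `A_a` (chain rule: `dA_a = A_a`,
`dι = id`). [folklore] -/
theorem mfderiv_stretchChart_apply (a : ℝ) (x : (hypBackground ⊤).domain) (v : E4) :
    mfderiv 𝓘(ℝ, E4) 𝓘(ℝ, E4) (stretchChart a) x v = timeStretch a v := by
  have hval : MDifferentiableAt 𝓘(ℝ, E4) 𝓘(ℝ, E4)
      (Subtype.val : (hypBackground ⊤).domain → E4) x :=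
    (contMDiff_subtype_val (n := 1)).mdifferentiableAt one_ne_zero
  have hA : MDifferentiableAt 𝓘(ℝ, E4) 𝓘(ℝ, E4) (timeStretch a) x.1 :=
    (timeStretch a).mdifferentiableAt
  have hcomp : stretchChart a = (timeStretch a) ∘ (Subtype.val : (hypBackground ⊤).domain → E4) :=
    rfl
  rw [hcomp, mfderiv_comp_apply x hA hval, ContinuousLinearMap.mfderiv_eq,
    OpensChart.mfderiv_subtypeVal_apply]
  rfl

/-- The metric deviation of the stretched chart from `η` is the constant form
`−(a² − 1) dx⁰ ⊗ dx⁰` at every point. [folklore] -/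
theorem deviation_stretchChart (a : ℝ) (x : (hypBackground ⊤).domain) :
    vacuumCauchyDevelopment.toSpacetime.deviation (hypBackground ⊤) (stretchChart a) x =
      stretchDefect a := by
  ext v w
  rw [Spacetime.deviation_apply, stretchDefect_apply]
  change bilin (mfderiv 𝓘(ℝ, E4) 𝓘(ℝ, E4) (stretchChart a) x v)
      (mfderiv 𝓘(ℝ, E4) 𝓘(ℝ, E4) (stretchChart a) x w) - bilin v w = _
  rw [mfderiv_stretchChart_apply, mfderiv_stretchChart_apply]
  exact bilin_timeStretch_sub a v w

/-- Hence the zero-extended deviation of the stretched chart is the constant `−(a² − 1) dx⁰ ⊗ dx⁰`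
on all of `E4` (every point is charted). [folklore] -/
theorem deviationExtend_stretchChart (a : ℝ) :
    vacuumCauchyDevelopment.toSpacetime.deviationExtend (hypBackground ⊤) (stretchChart a) =
      fun _ => stretchDefect a := by
  funext y
  have h := vacuumCauchyDevelopment.toSpacetime.deviationExtend_coe (hypBackground ⊤)
    (stretchChart a) ⟨y, trivial⟩
  rw [deviation_stretchChart] at h
  exact h

/-- **The `Cᵏ` deviation of the stretched chart is at most `|a² − 1|`** on every slab, for every
`k`: it is the `Cᵏ` sup norm of a constant. [folklore] -/
theorem deviationCk_stretchChart_le (a : ℝ) (k : ℕ) (τ : ℝ) :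
    vacuumCauchyDevelopment.toSpacetime.deviationCk (hypBackground ⊤) (stretchChart a) k τ ≤
      ENNReal.ofReal |a ^ 2 - 1| := by
  rw [Spacetime.deviationCk, deviationExtend_stretchChart]
  refine (supCkENorm_const_le _ k _).trans ?_
  rw [← ofReal_norm]
  exact ENNReal.ofReal_le_ofReal (norm_stretchDefect_le a)

/-! ### The stretched leaf and its causal properties -/

/-- The **time-stretched unit hyperboloid** `stretchLeaf a = A_a({t₀ = 0}) = {y | y⁰ = a √(1 + |y̲|²)}`:
the slab image of the stretched flat chart. O'Neill 1983, Ch. 14, p. 402 (hyperquadrics of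
`ℝ⁴₁`). [cite: ONeillSemiRiemannian1983, Ch. 14, p. 402] -/
def stretchLeaf (a : ℝ) : Set E4 := stretchChart a '' (hypBackground ⊤).timeSlab 0

/-- `|r| ≤ √(1 + r²)`. [folklore] -/
theorem abs_le_sqrt_one_add_sq (r : ℝ) : |r| ≤ √(1 + r ^ 2) :=
  (Real.le_sqrt (abs_nonneg r) (by positivity)).2 (by rw [sq_abs]; linarith)

/-- `√(1 + r²) ≤ |r| + 1`. [folklore] -/
theorem sqrt_one_add_sq_le (r : ℝ) : √(1 + r ^ 2) ≤ |r| + 1 := by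
  rw [Real.sqrt_le_left (by positivity)]
  nlinarith [abs_nonneg r, sq_abs r]

/-- The hyperboloidal time of `(hypBackground ⊤)` is `t₀(x) = x⁰ − √(1 + |x̲|²)` (restated with the
spatial norm unfolded). [folklore] -/
theorem hypTime_eq (x : E4) :
    (hypBackground ⊤).time x = x 0 - √(1 + ‖E4.spatial x‖ ^ 2) := rfl

/-- The hyperboloidal time is continuous. [folklore] -/
theorem continuous_hypTime : Continuous fun x : E4 => (hypBackground ⊤).time x := by
  simp only [hypTime_eq]
  exact (EuclideanSpace.proj (0 : Fin 4)).continuous.sub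
    ((continuous_const.add ((continuous_norm.comp E4.spatial.continuous).pow 2)).sqrt)

/-- On the layer `{−1 < t₀}` the Cartesian time is positive: `x⁰ > t₀(x) + 1 ≥ 0`. [folklore] -/
theorem pos_of_neg_one_lt_hypTime {x : E4} (hx : -1 < (hypBackground ⊤).time x) : 0 < x 0 := by
  rw [hypTime_eq] at hx
  have h1 : (1 : ℝ) ≤ √(1 + ‖E4.spatial x‖ ^ 2) :=
    (Real.le_sqrt zero_le_one (by positivity)).2 (by nlinarith)
  linarith

/-- Sliding a point down by its hyperboloidal time lands on the slab `{t₀ = 0}`: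
`t₀(x − t₀(x) ∂₀) = 0`. [folklore] -/
theorem hypTime_sub_smul_basisVector (x : E4) (c : ℝ) :
    (hypBackground ⊤).time (x - c • E4.basisVector 0) = (hypBackground ⊤).time x - c := by
  rw [hypTime_eq, hypTime_eq, map_sub, C0Extension.spatial_smul_basisVector, sub_zero]
  simp
  ring

/-- The points `(a √(1 + ‖y‖²), y)` lie on the stretched leaf (they are the images of the
hyperboloid points `(√(1 + ‖y‖²), y)`). [folklore] -/
theorem ofTimeSpace_mem_stretchLeaf (a : ℝ) (y : E3) :
    E4.ofTimeSpace (a * √(1 + ‖y‖ ^ 2)) y ∈ stretchLeaf a := by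
  refine ⟨⟨E4.ofTimeSpace (√(1 + ‖y‖ ^ 2)) y, trivial⟩, ?_, ?_⟩
  · rw [ModelBackground.mem_timeSlab, hypTime_eq]
    simp
  · rw [stretchChart_apply, timeStretch_ofTimeSpace]

/-- **Straight timelike segments.** If `‖x̲ − k̲‖ < x⁰ − k⁰` then `x ∈ I⁺(k)` in the Minkowski
development: the affine segment from `k` to `x` is a future-directed timelike curve (its constant
velocity `v = x − k` has `η(v,v) = −(v⁰)² + ‖v̲‖² < 0`, `v⁰ > 0`). O'Neill 1983, Ch. 14, p. 402
(`I⁺(p)` in `ℝ⁴₁`). [cite: ONeillSemiRiemannian1983, Ch. 14, p. 402] -/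
theorem mem_chronologicalFuture_of_norm_lt {k x : E4}
    (h : ‖E4.spatial x - E4.spatial k‖ < x 0 - k 0) :
    x ∈ (vacuumCauchyDevelopment.metric.chronologicalFuture
      vacuumCauchyDevelopment.timeOrientation {k} : Set E4) := by
  set v : E4 := x - k with hv
  have hvs : E4.spatial v = E4.spatial x - E4.spatial k := by rw [hv, map_sub]
  have hv0' : v 0 = x 0 - k 0 := by simp [hv]
  have hv0 : 0 < v 0 := by rw [hv0']; exact (norm_nonneg _).trans_lt h
  have hns : ‖E4.spatial v‖ < v 0 := by rw [hvs, hv0']; exact h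
  have htl : bilin v v < 0 := by
    rw [C0Extension.bilin_self_eq]
    nlinarith [norm_nonneg (E4.spatial v)]
  have hvne : v ≠ 0 := fun h0 ↦ by rw [h0] at hv0; simp at hv0
  refine ⟨k, rfl, fun σ : ℝ ↦ k + σ • v, 0, 1, zero_lt_one, fun σ _ ↦ ?_, by simp, by simp [hv]⟩
  have hγ : HasDerivAt (fun σ : ℝ ↦ k + σ • v) v σ := by
    simpa using ((hasDerivAt_id σ).smul_const v).const_add k
  have hmd : MDifferentiableAt 𝓘(ℝ, ℝ) 𝓘(ℝ, E4) (fun σ : ℝ ↦ k + σ • v) σ :=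
    mdifferentiableAt_iff_differentiableAt.mpr hγ.differentiableAt
  have hvel : velocity 𝓘(ℝ, E4) (fun σ : ℝ ↦ k + σ • v) σ = v := ModelSpace.velocity_line k v σ
  refine ⟨hmd, ?_, ⟨?_, ?_⟩, ?_⟩
  · change bilin (velocity 𝓘(ℝ, E4) (fun σ : ℝ ↦ k + σ • v) σ)
      (velocity 𝓘(ℝ, E4) (fun σ : ℝ ↦ k + σ • v) σ) < 0
    rw [hvel]; exact htl
  · change bilin (velocity 𝓘(ℝ, E4) (fun σ : ℝ ↦ k + σ • v) σ)
      (velocity 𝓘(ℝ, E4) (fun σ : ℝ ↦ k + σ • v) σ) ≤ 0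
    rw [hvel]; exact htl.le
  · change velocity 𝓘(ℝ, E4) (fun σ : ℝ ↦ k + σ • v) σ ≠ 0
    rw [hvel]; exact hvne
  · change bilin (E4.basisVector 0) (velocity 𝓘(ℝ, E4) (fun σ : ℝ ↦ k + σ • v) σ) < 0
    rw [hvel, bilin_basisVector_zero_left]
    linarith

/-- **For `a > 1` every point of Minkowski space lies in the causal past of the stretched leaf**:
given `q`, the leaf point over `ρ e₁` with `(a − 1) ρ ≥ |q⁰| + ‖q̲‖` is causally after `q`
(`a √(1+ρ²) − q⁰ ≥ aρ − |q⁰| ≥ ρ + ‖q̲‖ ≥ ‖ρ e₁ − q̲‖`). So `J⁻(stretchLeaf a) = E4`, which is why the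
barrier clause of `IsNearKerrLeaf` holds trivially for the stretched chart. O'Neill 1983, Ch. 14,
p. 402 (`J⁻` in `ℝ⁴₁`). [cite: ONeillSemiRiemannian1983, Ch. 14, p. 402] -/
theorem mem_causalPast_stretchLeaf {a : ℝ} (ha : 1 < a) (q : E4) :
    q ∈ (vacuumCauchyDevelopment.metric.causalPast vacuumCauchyDevelopment.timeOrientation
      (stretchLeaf a) : Set E4) := by
  set ρ : ℝ := (|q 0| + ‖E4.spatial q‖) / (a - 1) + 1 with hρ
  have ha1 : 0 < a - 1 := by linarith
  have hρ0 : 0 ≤ ρ := by rw [hρ]; positivity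
  have hρa : |q 0| + ‖E4.spatial q‖ ≤ (a - 1) * ρ := by
    rw [hρ, mul_add, mul_div_cancel₀ _ ha1.ne', mul_one]
    linarith
  set e : E3 := EuclideanSpace.single (0 : Fin 3) (1 : ℝ) with he
  have hne1 : ‖e‖ = 1 := by simp [he]
  have he1 : ‖ρ • e‖ = ρ := by
    rw [norm_smul, hne1, mul_one, Real.norm_eq_abs, abs_of_nonneg hρ0]
  set s' : E4 := E4.ofTimeSpace (a * √(1 + ‖ρ • e‖ ^ 2)) (ρ • e) with hs'
  have hs'S : s' ∈ stretchLeaf a := ofTimeSpace_mem_stretchLeaf a (ρ • e)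
  have hq : q ∈ (vacuumCauchyDevelopment.metric.causalPast vacuumCauchyDevelopment.timeOrientation
      ({s'} : Set E4) : Set E4) := by
    refine mem_causalPast_vacuumCauchyDevelopment ?_
    rw [hs', E4.spatial_ofTimeSpace, E4.ofTimeSpace_apply_zero, he1]
    have h1 : ‖ρ • e - E4.spatial q‖ ≤ ρ + ‖E4.spatial q‖ := by
      refine (norm_sub_le _ _).trans ?_
      rw [he1]
    have h2 : ρ ≤ √(1 + ρ ^ 2) := (le_abs_self ρ).trans (abs_le_sqrt_one_add_sq ρ)
    have h3 : q 0 ≤ |q 0| := le_abs_self _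
    nlinarith
  exact LorentzianMetric.causalFuture_mono (g := vacuumCauchyDevelopment.metric)
    (singleton_subset_iff.2 hs'S) hq

/-! ### The stretched hyperboloid is a near-Kerr leaf with 0 holes -/

/-- **The time-stretched unit hyperboloid is an `(s, k)`-near-Kerr leaf of Minkowski space with
`0` holes**, for every `k` and every `s > 0` (`a = √(1 + s)`): flat chart `Ψ₀ = A_a ∘ ι` on
`U₀ = ⊤` — smooth, an open embedding of the layer (a linear automorphism after two open
inclusions), with layer image in `J⁺({x⁰ = 0})` (positive times), `Cᵏ` deviation from `η` equal to
the constant `s`-multiple of `dx⁰ ⊗ dx⁰`; upper layer in `I⁺(S)` (vertical translates of slab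
points); barrier clause from `J⁻(S) = E4` (`mem_causalPast_stretchLeaf`). All `Fin 0`-indexed
hole clauses are vacuous. The leaf `stretchLeaf a` is timelike outside radius `s^{-1/2}`
(`exists_mem_chronologicalFuture_stretchLeaf`). DHRT arXiv:2104.08222, §1 (the vocabulary);
O'Neill 1983, Ch. 14, p. 402 (causality of `ℝ⁴₁`). [cite: ONeillSemiRiemannian1983, Ch. 14, p. 402] -/
theorem isNearKerrLeaf_stretchLeaf (k : ℕ) {s : ℝ} (hs : 0 < s) :
    vacuumCauchyDevelopment.toCauchyDevelopment.IsNearKerrLeaf k (ENNReal.ofReal s) 0 ![] ![]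
      (stretchLeaf (√(1 + s))) := by
  set a : ℝ := √(1 + s) with ha_def
  have ha1 : 1 < a := by
    rw [ha_def]
    exact (Real.lt_sqrt zero_le_one).2 (by nlinarith)
  have ha0 : 0 < a := one_pos.trans ha1
  have hasq : a ^ 2 - 1 = s := by rw [ha_def, Real.sq_sqrt (by linarith)]; ring
  -- the layer `L₀ = {−1 < t₀ < 1}` of the flat chart is open
  set L₀ : Set (hypBackground ⊤).domain :=
    {x | -1 < (hypBackground ⊤).time x.1 ∧ (hypBackground ⊤).time x.1 < 1} with hL₀
  have hL₀open : IsOpen L₀ :=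
    isOpen_Ioo.preimage (continuous_hypTime.comp continuous_subtype_val)
  refine ⟨![], ![], Fin.elim0, Fin.elim0, Fin.elim0, ⊤, hypBackground ⊤, fun i => i.elim0,
    stretchChart a, fun i => i.elim0, fun i => i.elim0, L₀,
    {x | 0 < (hypBackground ⊤).time x.1 ∧ (hypBackground ⊤).time x.1 < 1},
    fun i => i.elim0, fun i => i.elim0, rfl, fun i => i.elim0, rfl, rfl, fun i => i.elim0,
    fun x _ => trivial, fun i => i.elim0, (contMDiff_stretchChart a).contMDiffOn, ?_, ?_,
    fun i => i.elim0, ?_, fun i => i.elim0, fun i => i.elim0, fun i => i.elim0, ?_, ?_, ?_⟩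
  · -- open embedding of the layer: `A_a ∘ ι_⊤ ∘ ι_{L₀}`
    have h := (timeStretchEquiv a ha0.ne').toHomeomorph.isOpenEmbedding.comp
      ((IsOpen.isOpenEmbedding_subtypeVal (⊤ : Opens E4).2).comp
        hL₀open.isOpenEmbedding_subtypeVal)
    exact h
  · -- the layer image lies in `J⁺({x⁰ = 0})`
    rintro _ ⟨x, hx, rfl⟩
    have hx0 : 0 < x.1 0 := pos_of_neg_one_lt_hypTime hx.1
    set p : E4 := E4.ofTimeSpace 0 (E4.spatial (timeStretch a x.1)) with hp
    have hpr : p ∈ range vacuumCauchyDevelopment.toCauchyDevelopment.embed := by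
      change p ∈ range sliceEmbed
      rw [E4.mem_range_sliceEmbed_iff]
      simp [hp]
    refine LorentzianMetric.causalFuture_mono (g := vacuumCauchyDevelopment.metric)
      (singleton_subset_iff.2 hpr) (mem_causalFuture_vacuumCauchyDevelopment ?_)
    rw [stretchChart_apply, hp, E4.spatial_ofTimeSpace, sub_self, norm_zero,
      E4.ofTimeSpace_apply_zero, sub_zero, timeStretch_apply_zero]
    positivity
  · -- `Cᵏ` deviation of the stretched chart
    refine (deviationCk_stretchChart_le a k 0).trans (le_of_eq ?_)
    rw [hasq, abs_of_pos hs]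
  · -- the leaf is the slab image (no hole pieces)
    rw [iUnion_of_empty, union_empty]
    rfl
  · -- the upper layer lies in `I⁺(S)`: slide each point down to the slab
    rw [iUnion_of_empty, union_empty]
    rintro _ ⟨x, hx, rfl⟩
    set c : ℝ := (hypBackground ⊤).time x.1 with hc
    set x' : (hypBackground ⊤).domain := ⟨x.1 - c • E4.basisVector 0, trivial⟩ with hx'
    have hx'0 : (hypBackground ⊤).time x'.1 = 0 := by
      rw [hx', hypTime_sub_smul_basisVector, hc, sub_self]
    have hmem : stretchChart a x' ∈ stretchLeaf a := ⟨x', hx'0, rfl⟩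
    refine LorentzianMetric.chronologicalFuture_mono (g := vacuumCauchyDevelopment.metric)
      (singleton_subset_iff.2 hmem) (mem_chronologicalFuture_of_norm_lt ?_)
    rw [stretchChart_apply, stretchChart_apply, spatial_timeStretch, spatial_timeStretch, hx',
      map_sub, C0Extension.spatial_smul_basisVector, sub_zero, sub_self, norm_zero,
      timeStretch_apply_zero, timeStretch_apply_zero]
    have : (x.1 - c • E4.basisVector 0) 0 = x.1 0 - c := by simp
    rw [this]
    nlinarith [hx.1]
  · -- barrier clause: everything is in `J⁻(S)`
    exact fun q _ => mem_causalPast_stretchLeaf ha1 q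

/-- **Anti-vacuity of `IsNearKerrLeaf`**: for every order `k` and every tolerance `ε > 0` the
Minkowski development of the trivial data has an `(ε, k)`-near-Kerr leaf with `0` holes (the
stretched hyperboloid with `s = min ε 1`, and monotonicity in `ε`). DHRT arXiv:2104.08222, §1.
[cite: DafermosHolzegelRodnianskiTaylor2021, §1] -/
theorem exists_isNearKerrLeaf (k : ℕ) {ε : ℝ≥0∞} (hε : 0 < ε) :
    ∃ S : Set E4, vacuumCauchyDevelopment.toCauchyDevelopment.IsNearKerrLeaf k ε 0 ![] ![] S := by
  have hne : min ε 1 ≠ ⊤ := (min_le_right _ _).trans_lt ENNReal.one_lt_top |>.ne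
  have h0 : 0 < (min ε 1).toReal := ENNReal.toReal_pos (lt_min hε one_pos).ne' hne
  refine ⟨_, (isNearKerrLeaf_stretchLeaf k h0).mono le_rfl ?_⟩
  rw [ENNReal.ofReal_toReal hne]
  exact min_le_left _ _

/-! ### The stretched leaf is not achronal -/

/-- **The stretched leaf contains two chronologically related points**: for `a > 1` put
`ρ = 2/(a − 1)`; the leaf points `q = (a√(1+ρ²), ρ e₁)` and `q' = (a√(1+(ρ+1)²), (ρ+1) e₁)` satisfy
`q' ∈ I⁺(q)`, because `a(√(1+(ρ+1)²) − √(1+ρ²)) ≥ a(2ρ+1)/(2ρ+3) > 1 = ‖q̲' − q̲‖`. Hence a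
near-Kerr leaf need not be achronal (the stretched leaf is timelike outside radius
`(a² − 1)^{-1/2}`). O'Neill 1983, Ch. 14, p. 402. [cite: ONeillSemiRiemannian1983, Ch. 14, p. 402] -/
theorem exists_mem_chronologicalFuture_stretchLeaf {a : ℝ} (ha : 1 < a) :
    ∃ q ∈ stretchLeaf a, ∃ q' ∈ stretchLeaf a,
      q' ∈ (vacuumCauchyDevelopment.metric.chronologicalFuture
        vacuumCauchyDevelopment.timeOrientation {q} : Set E4) := by
  set ρ : ℝ := 2 / (a - 1) with hρ
  have ha1 : 0 < a - 1 := by linarith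
  have hρ0 : 0 < ρ := by rw [hρ]; positivity
  have hρa : (a - 1) * ρ = 2 := by rw [hρ, mul_div_cancel₀ _ ha1.ne']
  set e : E3 := EuclideanSpace.single (0 : Fin 3) (1 : ℝ) with he
  have hne : ‖e‖ = 1 := by simp [he]
  have hn : ∀ c : ℝ, 0 ≤ c → ‖c • e‖ = c := fun c hc ↦ by
    rw [norm_smul, hne, mul_one, Real.norm_eq_abs, abs_of_nonneg hc]
  refine ⟨_, ofTimeSpace_mem_stretchLeaf a (ρ • e), _, ofTimeSpace_mem_stretchLeaf a ((ρ + 1) • e),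
    mem_chronologicalFuture_of_norm_lt ?_⟩
  rw [E4.spatial_ofTimeSpace, E4.spatial_ofTimeSpace, E4.ofTimeSpace_apply_zero,
    E4.ofTimeSpace_apply_zero, hn ρ hρ0.le, hn (ρ + 1) (by linarith), ← sub_smul,
    add_sub_cancel_left, one_smul, hne, ← mul_sub]
  -- `1 < a (√(1+(ρ+1)²) − √(1+ρ²))`
  set u := √(1 + (ρ + 1) ^ 2) with hu
  set w := √(1 + ρ ^ 2) with hw
  have hu0 : 0 ≤ u := Real.sqrt_nonneg _
  have hw0 : 0 ≤ w := Real.sqrt_nonneg _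
  have husq : u ^ 2 = 1 + (ρ + 1) ^ 2 := by rw [hu, Real.sq_sqrt (by positivity)]
  have hwsq : w ^ 2 = 1 + ρ ^ 2 := by rw [hw, Real.sq_sqrt (by positivity)]
  have hule : u ≤ (ρ + 1) + 1 := by
    have := sqrt_one_add_sq_le (ρ + 1)
    rwa [abs_of_nonneg (by linarith)] at this
  have hwle : w ≤ ρ + 1 := by
    have := sqrt_one_add_sq_le ρ
    rwa [abs_of_nonneg hρ0.le] at this
  -- (u - w)(u + w) = 2ρ + 1 and u + w ≤ 2ρ + 3
  have hprod : (u - w) * (u + w) = 2 * ρ + 1 := by nlinarith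
  have hu1 : (1 : ℝ) ≤ u := (Real.le_sqrt zero_le_one (by positivity)).2 (by nlinarith)
  have hw1 : (1 : ℝ) ≤ w := (Real.le_sqrt zero_le_one (by positivity)).2 (by nlinarith)
  have hsum : 0 < u + w := by linarith
  have hdiff : (2 * ρ + 1) / (2 * ρ + 3) ≤ u - w := by
    rw [div_le_iff₀ (by linarith)]
    nlinarith
  have hkey : 2 * ρ + 3 < a * (2 * ρ + 1) := by nlinarith
  calc (1 : ℝ) < a * ((2 * ρ + 1) / (2 * ρ + 3)) := by
        rw [← mul_div_assoc, one_lt_div (by linarith)]; exact hkey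
    _ ≤ a * (u - w) := mul_le_mul_of_nonneg_left hdiff (by linarith)

/-- Hence **some `(ε, k)`-near-Kerr leaf of Minkowski space is not achronal**, for every `k` and
every `ε > 0`. [folklore] -/
theorem exists_isNearKerrLeaf_not_achronal (k : ℕ) {ε : ℝ≥0∞} (hε : 0 < ε) :
    ∃ S : Set E4, vacuumCauchyDevelopment.toCauchyDevelopment.IsNearKerrLeaf k ε 0 ![] ![] S ∧
      ∃ q ∈ S, ∃ q' ∈ S, q' ∈ (vacuumCauchyDevelopment.metric.chronologicalFuture
        vacuumCauchyDevelopment.timeOrientation {q} : Set E4) := by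
  have hne : min ε 1 ≠ ⊤ := (min_le_right _ _).trans_lt ENNReal.one_lt_top |>.ne
  have h0 : 0 < (min ε 1).toReal := ENNReal.toReal_pos (lt_min hε one_pos).ne' hne
  have ha : 1 < √(1 + (min ε 1).toReal) := (Real.lt_sqrt zero_le_one).2 (by nlinarith)
  refine ⟨_, (isNearKerrLeaf_stretchLeaf k h0).mono le_rfl ?_,
    exists_mem_chronologicalFuture_stretchLeaf ha⟩
  rw [ENNReal.ofReal_toReal hne]
  exact min_le_left _ _

end Minkowski

end Literature.Geometry.Lorentzian

end
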